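import Literature.AlgebraicGeometry.Resolution.SncSaturatedCentre
import Literature.AlgebraicGeometry.Resolution.SpreadRestrict
import Literature.AlgebraicGeometry.Resolution.BlowupSequencesBaseChange
import Literature.AlgebraicGeometry.Resolution.SmoothOfRegularPerfectField
import Literature.AlgebraicGeometry.Resolution.HypersurfaceCentres
import Literature.AlgebraicGeometry.Resolution.HypersurfaceRestriction
import Mathlib.FieldTheory.Perfect
import HarnessLib

/-!
# Smooth saturated strata and relative Cartier divisors spread out from the generic fibre

Topic: `Literature/AlgebraicGeometry/Resolution`. The MODEL half of the simple normal crossings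
bookkeeping for the spreading-out argument (`SpreadsShapedFromGenericPoint`,
`CanonicalResolutionSpread.lean`; BGMW 2011, Def. 3.1.1 / Def. 3.1.3 (2)): from
`HasSNCWith (E_K) (C_K)` on the generic fibre `X_K` of `q : X → Spec A` (`A` a domain with
fraction field `K` of characteristic zero; `E_K`, `C_K` the pull-backs of a boundary `E` and a
centre `C` on `X` along `jK : X_K → X`) to the hypotheses of the fibre-side theorem
`hasSNCWith_comap_of_smooth_satCentre` (`StrictNormalCrossingsFibre.lean`) over a dense open
`D(b) ⊆ Spec A`. Everything is PROVED:

* generic identification and consequences (`comap_satCentre_sup_finsetSup`;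
  `isRegular_subscheme_comap_satCentre_sup`, `isEffectiveCartier_comap_satCentre_sup_generic`,
  `isRegular_subscheme_comap_satCentre_sup_sup`) — for finite sets `B, T` of members of `E` on
  which `jK^*` is injective, the saturated stratum `V := satCentre C B ⊔ ∑_{K∈T} K` pulls back to
  the corresponding saturated stratum of `(E_K, C_K)`, a REGULAR scheme, on which every `D₀ ∈ B`
  with `jK^*D₀ ∉ jK^*T` restricts to an effective Cartier divisor, with regular zero scheme
  (`SncSaturatedCentre.lean`);
* subscheme plumbing (`isPullback_subschemeMap_comap`: the generic fibre / any fibre of the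
  closed subscheme `V(V)` is `V(ι^*V)`; `comap_comap_subschemeMap` (`SpreadRestrict.lean`),
  `isEffectiveCartier_comap_comap_subschemeι`: relative Cartier divisors on `V(V)` specialize,
  Stacks 056P; `comap_sup_comap_subschemeι`, `isRegular_subscheme_comap_subschemeι_iff_sup`: the
  zero scheme of `D₀ · 𝒪_{V(V)}` is `V(V ⊔ D₀)`);
* spreading (`exists_forall_mem_smoothLocus_of_isRegular_comap`: a closed subscheme with regular
  generic fibre is smooth over `Spec A` above some `D(b)`, by
  `exists_forall_mem_smoothLocus_of_smooth_generic`; `exists_forall_mem_cartierLocus_comap_subschemeι`: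
  a divisor restricting to an effective Cartier divisor on the generic fibre of `V(V)` lies in
  the Cartier locus above some `D(b)`, by `exists_forall_mem_cartierLocus_of_generic`;
  `exists_forall_mem_smoothLocus_comap_subschemeι`: its zero scheme is smooth above some `D(b)`);
* the combinations `HasSNCWith.exists_forall_mem_smoothLocus_satCentre_sup`,
  `HasSNCWith.exists_forall_mem_cartierLocus_satCentre_sup`,
  `HasSNCWith.exists_forall_mem_smoothLocus_zeroScheme_satCentre_sup`.

## Sources

* E. Bierstone, D. Grigoriev, P. Milman, J. Włodarczyk, arXiv:1206.3090, Def. 3.1.1,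
  Def. 3.1.3 (2). [BierstoneGrigorievMilmanWlodarczyk2011]
* A. Grothendieck, J. Dieudonné, EGA IV₃ (1966) §9, IV₄ (1967) 17.7.8, (21.15.9) (spreading
  out of smoothness and of relative Cartier divisors). [folklore]
* The Stacks Project, Tags 056P, 056S, 01WS. [StacksProject]
-/

noncomputable section

open CategoryTheory CategoryTheory.Limits AlgebraicGeometry TopologicalSpace IsLocalRing
  PrimeSpectrum

namespace Literature.AlgebraicGeometry.Resolution

universe u

open Scheme.IdealSheafData

/-! ## Closed subschemes: fibres, restricted divisors, zero schemes -/

section Subschemes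

variable {X X' : Scheme.{u}} (f : X' ⟶ X)

/-- `(V ⊔ D₀) · 𝒪_{V(V)} = D₀ · 𝒪_{V(V)}`. [folklore] -/
theorem comap_sup_comap_subschemeι (V D₀ : X.IdealSheafData) :
    (V ⊔ D₀).comap V.subschemeι = D₀.comap V.subschemeι := by
  rw [(map_gc V.subschemeι).l_sup, comap_subschemeι_self, bot_sup_eq]

/-- **The zero scheme of `D₀ · 𝒪_{V(V)}` is regular iff `V(V ⊔ D₀)` is** (they are the same closed
subscheme of `X`, `HypersurfaceCentres.isRegular_subscheme_comap_subschemeι_iff`). [folklore] -/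
theorem isRegular_subscheme_comap_subschemeι_iff_sup (V D₀ : X.IdealSheafData) :
    Scheme.IsRegular (D₀.comap V.subschemeι).subscheme ↔ Scheme.IsRegular (V ⊔ D₀).subscheme := by
  rw [← comap_sup_comap_subschemeι, isRegular_subscheme_comap_subschemeι_iff V le_sup_left]

/-- `∑_{K∈T} K ⊔ D₀ = ∑_{K ∈ T ∪ {D₀}} K`. [folklore] -/
theorem finsetSup_sup_eq_sup_insert [DecidableEq X.IdealSheafData] (T : Finset X.IdealSheafData)
    (D₀ : X.IdealSheafData) : T.sup id ⊔ D₀ = (insert D₀ T).sup id := by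
  rw [Finset.sup_insert, id, sup_comm]

variable {D : Type u} (k : Type u) [CommRing D] [CommRing k] [Algebra D k]
  (q : X ⟶ Spec (.of D)) {ι : X' ⟶ X} {sk : X' ⟶ Spec (.of k)}

/-- **The fibre of the closed subscheme `V(V)` is `V(ι^*V)`**: the natural morphism
`V(ι^*V) → V(V)` over `ι` (Mathlib's `subschemeMap`) forms a cartesian square with the
structure maps to `Spec k` and `Spec D` (`isPullback_subschemeι_comap` of
`BlowupSequencesBaseChange.lean`, rewritten). [folklore] -/
theorem isPullback_subschemeMap_comap (V : X.IdealSheafData)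
    (HX : IsPullback ι sk q (specOfAlgebra D k)) :
    IsPullback (subschemeMap (V.comap ι) V ι (V.le_map_comap ι)) ((V.comap ι).subschemeι ≫ sk)
      (V.subschemeι ≫ q) (specOfAlgebra D k) := by
  have h := isPullback_subschemeι_comap k q V HX
  rwa [comapIso_hom_snd] at h

/-- **A relative effective Cartier divisor on a closed subscheme of the model restricts to an
effective Cartier divisor on the corresponding closed subscheme of the fibre**: if `D₀ · 𝒪_{V(V)}`
is an effective Cartier divisor with zero scheme flat over `Spec D`, then
`(ι^*D₀) · 𝒪_{V(ι^*V)}` is an effective Cartier divisor (Stacks 056P,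
`IsEffectiveCartier.comap_fst_of_flat_subschemeι`). [cite: StacksProject, Tag 056P] -/
theorem isEffectiveCartier_comap_comap_subschemeι (V D₀ : X.IdealSheafData)
    (hcart : IsEffectiveCartier (D₀.comap V.subschemeι))
    [Flat ((D₀.comap V.subschemeι).subschemeι ≫ V.subschemeι ≫ q)]
    (HX : IsPullback ι sk q (specOfAlgebra D k)) :
    IsEffectiveCartier ((D₀.comap ι).comap (V.comap ι).subschemeι) := by
  have h := hcart.comap_fst_of_flat_subschemeι k (V.subschemeι ≫ q)
    (isPullback_subschemeMap_comap k q V HX)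
  rwa [comap_comap_subschemeMap] at h

end Subschemes

/-! ## The generic fibre: saturated strata of `(E_K, C_K)` -/

section Generic

variable {X XK : Scheme.{u}} [IsLocallyNoetherian X] [IsLocallyNoetherian XK] (jK : XK ⟶ X)
  [Flat jK] {E : List X.IdealSheafData} {C : X.IdealSheafData}

/-- **The saturated stratum pulls back to the saturated stratum of the pulled-back data** (flat
`jK` injective on `B`): `jK^*(satCentre C B ⊔ ∑_{K∈T} K) = satCentre (jK^*C) (jK^*B) ⊔ ∑_{K∈T} jK^*K`.
[cite: Matsumura1987, Thm. 7.4 (iii)] -/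
theorem comap_satCentre_sup_finsetSup [DecidableEq XK.IdealSheafData] (C : X.IdealSheafData)
    (B T : Finset X.IdealSheafData) (hinj : Set.InjOn (fun D : X.IdealSheafData => D.comap jK) B) :
    (satCentre C B ⊔ T.sup id).comap jK =
      satCentre (C.comap jK) (B.image fun D => D.comap jK) ⊔ (T.image fun K => K.comap jK).sup id := by
  rw [(map_gc jK).l_sup, comap_satCentre_of_flat_of_injOn jK C B hinj, comap_finsetSup]

omit [IsLocallyNoetherian X] [IsLocallyNoetherian XK] [Flat jK] in
/-- Members of `B ⊆ E` pull back to members of `E_K`. [folklore] -/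
theorem mem_map_of_mem_image [DecidableEq XK.IdealSheafData] {B : Finset X.IdealSheafData}
    (hB : ∀ K ∈ B, K ∈ E) {DK : XK.IdealSheafData} (hDK : DK ∈ B.image fun D => D.comap jK) :
    DK ∈ E.map fun K => K.comap jK := by
  obtain ⟨D, hD, rfl⟩ := Finset.mem_image.mp hDK
  exact List.mem_map.mpr ⟨D, hB D hD, rfl⟩

variable (hsnc : HasSNCWith (E.map fun K => K.comap jK) (C.comap jK))
include hsnc

/-- **The pulled-back saturated stratum is a regular scheme** (generic-fibre input for the
smoothness of `V(satCentre C B ⊔ ∑_{K∈T} K)` over the base).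
[cite: BierstoneGrigorievMilmanWlodarczyk2011, Def. 3.1.3 (2)] -/
theorem HasSNCWith.isRegular_subscheme_comap_satCentre_sup (B T : Finset X.IdealSheafData)
    (hT : ∀ K ∈ T, K ∈ E)
    (hinj : Set.InjOn (fun D : X.IdealSheafData => D.comap jK) B) :
    Scheme.IsRegular ((satCentre C B ⊔ T.sup id).comap jK).subscheme := by
  classical
  rw [comap_satCentre_sup_finsetSup jK C B T hinj]
  exact hsnc.isRegular_subscheme_satCentre_sup _ _
    fun K hK => mem_map_of_mem_image jK hT hK

/-- **On the pulled-back saturated stratum, `jK^*D₀` restricts to an effective Cartier divisor**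
for `D₀ ∈ B` in `E` with `jK^*D₀ ∉ jK^*T` (generic-fibre input for the relative Cartier
property of `D₀` on `V(satCentre C B ⊔ ∑_{K∈T} K)`).
[cite: BierstoneGrigorievMilmanWlodarczyk2011, Def. 3.1.3 (2)] -/
theorem HasSNCWith.isEffectiveCartier_comap_satCentre_sup_generic (B T : Finset X.IdealSheafData)
    (hT : ∀ K ∈ T, K ∈ E)
    (hinj : Set.InjOn (fun D : X.IdealSheafData => D.comap jK) B) {D₀ : X.IdealSheafData}
    (hD₀E : D₀ ∈ E) (hD₀B : D₀ ∈ B)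
    (hD₀T : ∀ K ∈ T, K.comap jK ≠ D₀.comap jK) :
    IsEffectiveCartier ((D₀.comap jK).comap ((satCentre C B ⊔ T.sup id).comap jK).subschemeι) := by
  classical
  rw [comap_satCentre_sup_finsetSup jK C B T hinj]
  refine hsnc.isEffectiveCartier_comap_subschemeι_satCentre_sup _ _
    (fun K hK => mem_map_of_mem_image jK hT hK) (List.mem_map.mpr ⟨D₀, hD₀E, rfl⟩)
    (Finset.mem_image.mpr ⟨D₀, hD₀B, rfl⟩) fun hmem => ?_
  obtain ⟨K, hK, hKD⟩ := Finset.mem_image.mp hmem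
  exact hD₀T K hK hKD

/-- **The pulled-back stratum cut with one more divisor `D₀ ∈ E` is a regular scheme**
(generic-fibre input for the flatness of the zero scheme of `D₀` on the stratum).
[cite: BierstoneGrigorievMilmanWlodarczyk2011, Def. 3.1.3 (2)] -/
theorem HasSNCWith.isRegular_subscheme_comap_satCentre_sup_sup (B T : Finset X.IdealSheafData)
    (hT : ∀ K ∈ T, K ∈ E)
    (hinj : Set.InjOn (fun D : X.IdealSheafData => D.comap jK) B) {D₀ : X.IdealSheafData}
    (hD₀E : D₀ ∈ E) :
    Scheme.IsRegular ((satCentre C B ⊔ T.sup id ⊔ D₀).comap jK).subscheme := by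
  classical
  rw [sup_assoc, finsetSup_sup_eq_sup_insert]
  refine hsnc.isRegular_subscheme_comap_satCentre_sup jK B _ (fun K hK => ?_) hinj
  rcases Finset.mem_insert.mp hK with rfl | hK
  · exact hD₀E
  · exact hT K hK

end Generic

/-! ## Spreading over the base -/

section Spread

variable {A : Type u} [CommRing A] [IsDomain A] [IsNoetherianRing A] (K : Type u) [Field K]
  [CharZero K] [Algebra A K] [IsFractionRing A K]
  {X XK : Scheme.{u}} (q : X ⟶ Spec (.of A)) [LocallyOfFiniteType q] [QuasiCompact q]
  {jK : XK ⟶ X} {qK : XK ⟶ Spec (.of K)} [LocallyOfFiniteType qK]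
  (HK : IsPullback jK qK q (specOfAlgebra A K))

omit [IsDomain A] in
/-- Over a Noetherian affine base, locally of finite type implies locally of finite
presentation. [folklore] -/
theorem locallyOfFinitePresentation_of_isNoetherianRing_base {Y : Scheme.{u}}
    (g : Y ⟶ Spec (.of A)) [LocallyOfFiniteType g] : LocallyOfFinitePresentation g := by
  rw [HasRingHomProperty.iff_appLE (P := @LocallyOfFinitePresentation)]
  intro U V e
  haveI := IsLocallyNoetherian.component_noetherian (X := Spec (.of A)) U
  exact RingHom.FinitePresentation.of_finiteType.mp
    (HasRingHomProperty.appLE @LocallyOfFiniteType g inferInstance U V e)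

include HK in
/-- **A closed subscheme of `X` with regular generic fibre is smooth over `Spec A` above some
`D(b)`, `b ≠ 0`**: its generic fibre `V(jK^*V)` (`isPullback_subschemeMap_comap`) is smooth over
the perfect field `K` (`smooth_of_isRegular_of_perfectField`), and smoothness spreads
(`exists_forall_mem_smoothLocus_of_smooth_generic`). [folklore] -/
theorem exists_forall_mem_smoothLocus_of_isRegular_comap (V : X.IdealSheafData)
    (hreg : Scheme.IsRegular (V.comap jK).subscheme) :
    ∃ b : A, b ≠ 0 ∧ ∀ z : V.subscheme,
      (V.subschemeι ≫ q) z ∈ (basicOpen b : Set (PrimeSpectrum A)) →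
        z ∈ (V.subschemeι ≫ q).smoothLocus := by
  haveI : IsLocallyNoetherian X := LocallyOfFiniteType.isLocallyNoetherian q
  haveI : CompactSpace X := QuasiCompact.compactSpace_of_compactSpace q
  haveI : IsLocallyNoetherian V.subscheme := LocallyOfFiniteType.isLocallyNoetherian V.subschemeι
  haveI : CompactSpace V.subscheme := QuasiCompact.compactSpace_of_compactSpace V.subschemeι
  haveI : IsNoetherian V.subscheme := {}
  haveI : LocallyOfFinitePresentation (V.subschemeι ≫ q) :=
    locallyOfFinitePresentation_of_isNoetherianRing_base _
  haveI : PerfectField K := PerfectField.ofCharZero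
  -- the generic fibre of `V(V) → Spec A` is `V(jK^*V)`, smooth over `K`
  have H := isPullback_subschemeMap_comap K q V HK
  haveI : LocallyOfFiniteType ((V.comap jK).subschemeι ≫ qK) := inferInstance
  have hsmK : Smooth ((V.comap jK).subschemeι ≫ qK) := smooth_of_isRegular_of_perfectField _ hreg
  have hsm : Smooth (pullback.snd (V.subschemeι ≫ q) (specOfAlgebra A K)) := by
    have he : pullback.snd (V.subschemeι ≫ q) (specOfAlgebra A K) =
        H.isoPullback.inv ≫ ((V.comap jK).subschemeι ≫ qK) :=
      (Iso.eq_inv_comp _).mpr H.isoPullback_hom_snd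
    rw [he]
    infer_instance
  exact exists_forall_mem_smoothLocus_of_smooth_generic K (V.subschemeι ≫ q) hsm

omit [CharZero K] [LocallyOfFiniteType qK] in
include HK in
/-- **A divisor restricting to an effective Cartier divisor on the generic fibre of `V(V)` lies
in the Cartier locus of `D₀ · 𝒪_{V(V)}` above some `D(b)`, `b ≠ 0`**
(`exists_forall_mem_cartierLocus_of_generic` for the `A`-scheme `V(V)`, whose generic fibre is
`V(jK^*V)`). [cite: StacksProject, Tag 056P] -/
theorem exists_forall_mem_cartierLocus_comap_subschemeι (V D₀ : X.IdealSheafData)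
    (hcart : IsEffectiveCartier ((D₀.comap jK).comap (V.comap jK).subschemeι)) :
    ∃ b : A, b ≠ 0 ∧ ∀ z : V.subscheme,
      (V.subschemeι ≫ q) z ∈ (basicOpen b : Set (PrimeSpectrum A)) →
        z ∈ cartierLocus (D₀.comap V.subschemeι) := by
  haveI : IsLocallyNoetherian X := LocallyOfFiniteType.isLocallyNoetherian q
  haveI : CompactSpace X := QuasiCompact.compactSpace_of_compactSpace q
  haveI : IsLocallyNoetherian V.subscheme := LocallyOfFiniteType.isLocallyNoetherian V.subschemeι
  haveI : CompactSpace V.subscheme := QuasiCompact.compactSpace_of_compactSpace V.subschemeι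
  haveI : IsNoetherian V.subscheme := {}
  haveI : LocallyOfFinitePresentation (V.subschemeι ≫ q) :=
    locallyOfFinitePresentation_of_isNoetherianRing_base _
  have H := isPullback_subschemeMap_comap K q V HK
  -- transport the Cartier property along `V(jK^*V) ≅ V(V) ×_A Spec K`
  have hK : IsEffectiveCartier ((D₀.comap V.subschemeι).comap
      (pullback.fst (V.subschemeι ≫ q) (specOfAlgebra A K))) := by
    rw [← comap_comap_subschemeMap jK V D₀, ← H.isoPullback_hom_fst, comap_comp] at hcart
    have h := hcart.comap_iso H.isoPullback.symm
    rwa [← comap_comp, Iso.symm_hom, Iso.inv_hom_id, comap_id] at h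
  exact exists_forall_mem_cartierLocus_of_generic K (V.subschemeι ≫ q) _ hK

include HK in
/-- **The zero scheme of `D₀ · 𝒪_{V(V)}` is smooth over `Spec A` above some `D(b)`, `b ≠ 0`, when
`V(jK^*(V ⊔ D₀))` is regular** (`exists_forall_mem_smoothLocus_of_isRegular_comap` for the
`A`-scheme `V(V)` and the ideal `D₀ · 𝒪_{V(V)}`, whose generic-fibre counterpart is
`jK^*D₀ · 𝒪_{V(jK^*V)}` with zero scheme `V(jK^*V ⊔ jK^*D₀)`). [folklore] -/
theorem exists_forall_mem_smoothLocus_comap_subschemeι (V D₀ : X.IdealSheafData)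
    (hreg : Scheme.IsRegular ((V ⊔ D₀).comap jK).subscheme) :
    ∃ b : A, b ≠ 0 ∧ ∀ z : (D₀.comap V.subschemeι).subscheme,
      ((D₀.comap V.subschemeι).subschemeι ≫ V.subschemeι ≫ q) z ∈
          (basicOpen b : Set (PrimeSpectrum A)) →
        z ∈ ((D₀.comap V.subschemeι).subschemeι ≫ V.subschemeι ≫ q).smoothLocus := by
  haveI : IsLocallyNoetherian X := LocallyOfFiniteType.isLocallyNoetherian q
  haveI : IsLocallyNoetherian XK := LocallyOfFiniteType.isLocallyNoetherian qK
  have H := isPullback_subschemeMap_comap K q V HK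
  haveI : LocallyOfFiniteType (V.subschemeι ≫ q) := inferInstance
  haveI : QuasiCompact (V.subschemeι ≫ q) := inferInstance
  haveI : LocallyOfFiniteType ((V.comap jK).subschemeι ≫ qK) := inferInstance
  have hreg' : Scheme.IsRegular (((D₀.comap V.subschemeι).comap
      (subschemeMap (V.comap jK) V jK (V.le_map_comap jK))).subscheme) := by
    rw [comap_comap_subschemeMap, isRegular_subscheme_comap_subschemeι_iff_sup, ← (map_gc jK).l_sup]
    exact hreg
  exact exists_forall_mem_smoothLocus_of_isRegular_comap K (V.subschemeι ≫ q) H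
    (D₀.comap V.subschemeι) hreg'

/-! ### The three inputs of `hasSNCWith_comap_of_smooth_satCentre`, spread out -/

variable [IsLocallyNoetherian X] [IsLocallyNoetherian XK]
  {E : List X.IdealSheafData} {C : X.IdealSheafData}
  (hsnc : HasSNCWith (E.map fun K => K.comap jK) (C.comap jK))

include HK hsnc in
/-- **The saturated strata are smooth over the base above some `D(b)`** (`b ≠ 0`), for finite
sets `B, T ⊆ E` with `jK^*` injective on `B`.
[cite: BierstoneGrigorievMilmanWlodarczyk2011, Def. 3.1.3 (2)] -/
theorem HasSNCWith.exists_forall_mem_smoothLocus_satCentre_sup (B T : Finset X.IdealSheafData)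
    (hT : ∀ K ∈ T, K ∈ E)
    (hinj : Set.InjOn (fun D : X.IdealSheafData => D.comap jK) B) :
    ∃ b : A, b ≠ 0 ∧ ∀ z : (satCentre C B ⊔ T.sup id).subscheme,
      ((satCentre C B ⊔ T.sup id).subschemeι ≫ q) z ∈ (basicOpen b : Set (PrimeSpectrum A)) →
        z ∈ ((satCentre C B ⊔ T.sup id).subschemeι ≫ q).smoothLocus := by
  haveI : Flat jK := MorphismProperty.of_isPullback HK.flip (flat_specMap_fractionRing (A := A) K)
  exact exists_forall_mem_smoothLocus_of_isRegular_comap K q HK _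
    (hsnc.isRegular_subscheme_comap_satCentre_sup jK B T hT hinj)

omit [CharZero K] [LocallyOfFiniteType qK] in
include HK hsnc in
/-- **On the saturated strata, `D₀` lies in the Cartier locus above some `D(b)`** (`b ≠ 0`), for
`D₀ ∈ B` in `E` with `jK^*D₀ ∉ jK^*T`. [cite: BierstoneGrigorievMilmanWlodarczyk2011, Def. 3.1.3 (2)] -/
theorem HasSNCWith.exists_forall_mem_cartierLocus_satCentre_sup (B T : Finset X.IdealSheafData)
    (hT : ∀ K ∈ T, K ∈ E)
    (hinj : Set.InjOn (fun D : X.IdealSheafData => D.comap jK) B) {D₀ : X.IdealSheafData}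
    (hD₀E : D₀ ∈ E) (hD₀B : D₀ ∈ B) (hD₀T : ∀ K ∈ T, K.comap jK ≠ D₀.comap jK) :
    ∃ b : A, b ≠ 0 ∧ ∀ z : (satCentre C B ⊔ T.sup id).subscheme,
      ((satCentre C B ⊔ T.sup id).subschemeι ≫ q) z ∈ (basicOpen b : Set (PrimeSpectrum A)) →
        z ∈ cartierLocus (D₀.comap (satCentre C B ⊔ T.sup id).subschemeι) := by
  haveI : Flat jK := MorphismProperty.of_isPullback HK.flip (flat_specMap_fractionRing (A := A) K)
  exact exists_forall_mem_cartierLocus_comap_subschemeι K q HK _ _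
    (hsnc.isEffectiveCartier_comap_satCentre_sup_generic jK B T hT hinj hD₀E hD₀B hD₀T)

include HK hsnc in
/-- **The zero schemes of `D₀` on the saturated strata are smooth over the base above some
`D(b)`** (`b ≠ 0`), for `D₀ ∈ E`. [cite: BierstoneGrigorievMilmanWlodarczyk2011, Def. 3.1.3 (2)] -/
theorem HasSNCWith.exists_forall_mem_smoothLocus_zeroScheme_satCentre_sup
    (B T : Finset X.IdealSheafData) (hT : ∀ K ∈ T, K ∈ E)
    (hinj : Set.InjOn (fun D : X.IdealSheafData => D.comap jK) B) {D₀ : X.IdealSheafData}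
    (hD₀E : D₀ ∈ E) :
    ∃ b : A, b ≠ 0 ∧
      ∀ z : (D₀.comap (satCentre C B ⊔ T.sup id).subschemeι).subscheme,
        ((D₀.comap (satCentre C B ⊔ T.sup id).subschemeι).subschemeι ≫
            (satCentre C B ⊔ T.sup id).subschemeι ≫ q) z ∈ (basicOpen b : Set (PrimeSpectrum A)) →
          z ∈ ((D₀.comap (satCentre C B ⊔ T.sup id).subschemeι).subschemeι ≫
            (satCentre C B ⊔ T.sup id).subschemeι ≫ q).smoothLocus := by
  haveI : Flat jK := MorphismProperty.of_isPullback HK.flip (flat_specMap_fractionRing (A := A) K)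
  exact exists_forall_mem_smoothLocus_comap_subschemeι K q HK _ _
    (hsnc.isRegular_subscheme_comap_satCentre_sup_sup jK B T hT hinj hD₀E)

end Spread

end Literature.AlgebraicGeometry.Resolution

end
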